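import Summits.KontsevichZagierPeriods.KontsevichZagierPeriods.Theorems.FurushoPentagonPentagonInKZCornersCubicalAlgA
import Summits.KontsevichZagierPeriods.KontsevichZagierPeriods.Theorems.FurushoPentagonPentagonInKZCornersCubicalSides

/-!
# `PentagonInKZ` — stub `stub_cornersCubical`: the corner principle at the three cubical
vertices, I (aux)

Part I (charts C1, C2).
For each cubical corner chart C1, C2, C5 of the pentagon cell (`α = β = 1/2`, five bilinear
divisors, residues in `U𝔞₄`), the general log-free CORNER PRINCIPLE (hypothesis `CP`, the
statement of the lead's stub `stub_cornerPrinciple`, verbatim) is instantiated: the chart's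
letter densities (closed forms), the four side families of absolutely convergent iterated
integrals (`exists_sideFamily`), their end-regularised generating series, and the resulting
identity `V_α(β) · H_0(α) = H_β(α) · V_0(β)` in `U𝔞₄ ⊗ R/(deg > N)` at the chart's residues.
-/

noncomputable section

open Literature.NumberTheory.Transcendental

namespace Summit.KontsevichZagierPeriods.FurushoPentagon.PentagonInKZ

namespace CornersCubical

section Charts

variable
  (CP :
  (∀ (R : Type) [CommRing R] [Algebra ℚ R] (χ : KZ.FormalRep →+ R), (∀ c ∈ KZ.relations, χ c = 0)
    → (∀ x y : KZ.FormalRep, χ (x * y) = χ x * χ y) → (∃ u : KZ.FormalRep, χ u = 1) → ∀ (m N : ℕ)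
    (α β : ℚ), 0 < α → 0 < β → ∀ (cf : Fin (m + 2) → Fin 4 → ℚ), cf 0 = ![0, 1, 0, 0] → cf 1 =
    ![0, 0, 1, 0] → ∀ (φ f g : Fin (m + 2) → ℝ → ℝ → ℝ), (∀ k x y, φ k x y = cf k 0 + cf k 1 * x
    + cf k 2 * y + cf k 3 * x * y) → (∀ k x y, f k x y = (cf k 1 + cf k 3 * y) / φ k x y) → (∀ k
    x y, g k x y = (cf k 2 + cf k 3 * x) / φ k x y) → (∀ k : Fin (m + 2), k ≠ 0 → k ≠ 1 → ∀ x y :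
    ℝ, 0 ≤ x → x ≤ (α : ℝ) → 0 ≤ y → y ≤ (β : ℝ) → φ k x y ≠ 0) → ∀ (nZ : Fin (m + 2) → Fin 4 →
    Fin 4 → ℤ) (Zr : Fin (m + 2) → DrinfeldKohnoTrunc ℝ (Fin 4) N), (∀ k, Zr k = ∑ i : Fin 4, ∑ j
    : Fin 4, (nZ k i j : ℝ) • DrinfeldKohnoTrunc.t ℝ N i j) → Zr 0 * Zr 1 = Zr 1 * Zr 0 → (∀ x y
    : ℝ, 0 < x → x < (α : ℝ) → 0 < y → y < (β : ℝ) → ∑ k : Fin (m + 2), ∑ l : Fin (m + 2), (f k x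
    y * g l x y) • (Zr k * Zr l - Zr l * Zr k) = 0) → (∀ y : ℝ, 0 < y → y < (β : ℝ) → ∑ l : Fin
    (m + 2), g l 0 y • (Zr 0 * Zr l - Zr l * Zr 0) = 0) → (∀ x : ℝ, 0 < x → x < (α : ℝ) → ∑ k :
    Fin (m + 2), f k x 0 • (Zr 1 * Zr k - Zr k * Zr 1) = 0) → ∀ (IHlo IHhi IVlo IVhi : (w : List
    (Fin (m + 2))) → KZ.IntegralRep w.length), (∀ w : List (Fin (m + 2)), w.getLast? ≠ some 0 →
    (IHlo w).domain = {t | (∀ i, 0 < t i ∧ t i < (α : ℝ)) ∧ StrictAnti t} ∧ Set.EqOn (IHlo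
    w).integrand (fun t => ∏ i, f (w.get i) (t i) 0) (IHlo w).domain) → (∀ w : List (Fin (m +
    2)), w.getLast? ≠ some 0 → (IHhi w).domain = {t | (∀ i, 0 < t i ∧ t i < (α : ℝ)) ∧ StrictAnti
    t} ∧ Set.EqOn (IHhi w).integrand (fun t => ∏ i, f (w.get i) (t i) (β : ℝ)) (IHhi w).domain) →
    (∀ w : List (Fin (m + 2)), w.getLast? ≠ some 1 → (IVlo w).domain = {t | (∀ i, 0 < t i ∧ t i <
    (β : ℝ)) ∧ StrictAnti t} ∧ Set.EqOn (IVlo w).integrand (fun t => ∏ i, g (w.get i) 0 (t i))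
    (IVlo w).domain) → (∀ w : List (Fin (m + 2)), w.getLast? ≠ some 1 → (IVhi w).domain = {t | (∀
    i, 0 < t i ∧ t i < (β : ℝ)) ∧ StrictAnti t} ∧ Set.EqOn (IVhi w).integrand (fun t => ∏ i, g
    (w.get i) (α : ℝ) (t i)) (IVhi w).domain) → ∀ (PHlo PHhi PVlo PVhi : NCSeries (Fin (m + 2))
    R), (∀ W, PHlo W = if W = [] then 1 else Shuffle.pair (fun w => χ (KZ.of (IHlo w)))
    (Shuffle.regEnd 0 W)) → (∀ W, PHhi W = if W = [] then 1 else Shuffle.pair (fun w => χ (KZ.of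
    (IHhi w))) (Shuffle.regEnd 0 W)) → (∀ W, PVlo W = if W = [] then 1 else Shuffle.pair (fun w
    => χ (KZ.of (IVlo w))) (Shuffle.regEnd 1 W)) → (∀ W, PVhi W = if W = [] then 1 else
    Shuffle.pair (fun w => χ (KZ.of (IVhi w))) (Shuffle.regEnd 1 W)) → ∀ (Z : Fin (m + 2) →
    DrinfeldKohnoTrunc R (Fin 4) N), (∀ k, Z k = ∑ i : Fin 4, ∑ j : Fin 4, (nZ k i j : R) •
    DrinfeldKohnoTrunc.t R N i j) → NCSeries.evalTrunc N Z PVhi * NCSeries.evalTrunc N Z PHlo =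
    NCSeries.evalTrunc N Z PHhi * NCSeries.evalTrunc N Z PVlo))
  (R : Type) [CommRing R] [Algebra ℚ R] (χ : KZ.FormalRep →+ R)
  (hrel : ∀ c ∈ KZ.relations, χ c = 0) (hmul : ∀ x y : KZ.FormalRep, χ (x * y) = χ x * χ y)
  (hunit : ∃ u : KZ.FormalRep, χ u = 1) (N : ℕ)


/-- **The side families of chart C1** (vertex `(0,0)`, `(ξ,η) = (u,v)`): the divisors `φ_k`, the
letter densities `f_k = ∂_ξ log φ_k`, `g_k = ∂_η log φ_k` (with their closed forms) and the four
families of KZ representations of the iterated integrals along the sides `η = 0`, `η = 1/2`,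
`ξ = 0`, `ξ = 1/2` (words not ending in the side's regularised letter).
[cite: KontsevichZagier2001, §1.1] -/
theorem families_C1 :
    ∃ (cf : Fin 5 → Fin 4 → ℚ) (φ f g : Fin 5 → ℝ → ℝ → ℝ),
      cf = ![![0, 1, 0, 0], ![0, 0, 1, 0], ![1, -1, 0, 0], ![1, 0, -1, 0], ![1, 0, 0, -1]] ∧
      (∀ k x y, φ k x y = cf k 0 + cf k 1 * x + cf k 2 * y + cf k 3 * x * y) ∧
      (∀ k x y, f k x y = (cf k 1 + cf k 3 * y) / φ k x y) ∧
      (∀ k x y, g k x y = (cf k 2 + cf k 3 * x) / φ k x y) ∧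
      (∀ x y : ℝ, (f 0 x y = 1 / x ∧ f 1 x y = 0 ∧ f 2 x y = -1 / (1 - x) ∧ f 3 x y = 0 ∧
        f 4 x y = -y / (1 - x * y)) ∧ (g 0 x y = 0 ∧ g 1 x y = 1 / y ∧ g 2 x y = 0 ∧
        g 3 x y = -1 / (1 - y) ∧ g 4 x y = -x / (1 - x * y))) ∧
      ∃ IHlo IHhi IVlo IVhi : (w : List (Fin 5)) → KZ.IntegralRep w.length,
        (∀ w : List (Fin 5), w.getLast? ≠ some 0 →
          (IHlo w).domain = {t | (∀ i, 0 < t i ∧ t i < ((1 / 2 : ℚ) : ℝ)) ∧ StrictAnti t} ∧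
          Set.EqOn (IHlo w).integrand (fun t => ∏ i, f (w.get i) (t i) 0)
            (IHlo w).domain) ∧
        (∀ w : List (Fin 5), w.getLast? ≠ some 0 →
          (IHhi w).domain = {t | (∀ i, 0 < t i ∧ t i < ((1 / 2 : ℚ) : ℝ)) ∧ StrictAnti t} ∧
          Set.EqOn (IHhi w).integrand (fun t => ∏ i, f (w.get i) (t i) ((1 / 2 : ℚ) : ℝ))
            (IHhi w).domain) ∧
        (∀ w : List (Fin 5), w.getLast? ≠ some 1 →
          (IVlo w).domain = {t | (∀ i, 0 < t i ∧ t i < ((1 / 2 : ℚ) : ℝ)) ∧ StrictAnti t} ∧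
          Set.EqOn (IVlo w).integrand (fun t => ∏ i, g (w.get i) 0 (t i))
            (IVlo w).domain) ∧
        (∀ w : List (Fin 5), w.getLast? ≠ some 1 →
          (IVhi w).domain = {t | (∀ i, 0 < t i ∧ t i < ((1 / 2 : ℚ) : ℝ)) ∧ StrictAnti t} ∧
          Set.EqOn (IVhi w).integrand (fun t => ∏ i, g (w.get i) ((1 / 2 : ℚ) : ℝ) (t i))
            (IVhi w).domain) := by
  -- the chart: divisors and letter densities
  obtain ⟨cf, hcf⟩ : ∃ cf : Fin 5 → Fin 4 → ℚ,
      cf = ![![0, 1, 0, 0], ![0, 0, 1, 0], ![1, -1, 0, 0], ![1, 0, -1, 0], ![1, 0, 0, -1]] :=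
    ⟨_, rfl⟩
  obtain ⟨φ, f, g, hφ, hf, hg⟩ : ∃ φ f g : Fin 5 → ℝ → ℝ → ℝ,
      (∀ k x y, φ k x y = cf k 0 + cf k 1 * x + cf k 2 * y + cf k 3 * x * y) ∧
      (∀ k x y, f k x y = (cf k 1 + cf k 3 * y) / φ k x y) ∧
      (∀ k x y, g k x y = (cf k 2 + cf k 3 * x) / φ k x y) :=
    ⟨_, _, _, fun _ _ _ => rfl, fun _ _ _ => rfl, fun _ _ _ => rfl⟩
  have hfg := fg_C1 cf hcf φ f g hφ hf hg
  have hβq : ∃ q : ℚ, ((1 / 2 : ℚ) : ℝ) = q := ⟨1 / 2, rfl⟩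
  have hβ1 : ((1 / 2 : ℚ) : ℝ) ≤ 1 := by norm_num
  have hq : ((1 / 2 : ℚ) : ℝ) = 2⁻¹ := by norm_num
  obtain ⟨q1, q2, q3⟩ := poles_012
  obtain ⟨r1, r2, r3⟩ := poles_01m
  -- the four side families
  obtain ⟨IHlo, hIHlo⟩ := exists_sideFamily ((1 / 2 : ℚ) : ℝ) hβq hβ1 _ 0 q1 q2 q3
    (fun k s => f k s 0)
    (![some 0, none, some 1, none, none] : Fin 5 → Option (Fin 3)) 0 (by decide)
    (fun i s _ _ => by
      obtain ⟨⟨e0, e1, e2, e3, e4⟩, -, -, -⟩ := edge_C1 f g hfg s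
      fin_cases i <;> simp [e0, e1, e2, e3, e4])
  obtain ⟨IHhi, hIHhi⟩ := exists_sideFamily ((1 / 2 : ℚ) : ℝ) hβq hβ1 _ 0 q1 q2 q3
    (fun k s => f k s ((1 / 2 : ℚ) : ℝ))
    (![some 0, none, some 1, none, some 2] : Fin 5 → Option (Fin 3)) 0 (by decide)
    (fun i s _ _ => by
      obtain ⟨-, ⟨e0, e1, e2, e3, e4⟩, -, -⟩ := edge_C1 f g hfg s
      simp only [hq]
      fin_cases i <;> simp [e0, e1, e2, e3, e4])
  obtain ⟨IVlo, hIVlo⟩ := exists_sideFamily ((1 / 2 : ℚ) : ℝ) hβq hβ1 _ 0 q1 q2 q3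
    (fun k s => g k 0 s)
    (![none, some 0, none, some 1, none] : Fin 5 → Option (Fin 3)) 1 (by decide)
    (fun i s _ _ => by
      obtain ⟨-, -, ⟨e0, e1, e2, e3, e4⟩, -⟩ := edge_C1 f g hfg s
      fin_cases i <;> simp [e0, e1, e2, e3, e4])
  obtain ⟨IVhi, hIVhi⟩ := exists_sideFamily ((1 / 2 : ℚ) : ℝ) hβq hβ1 _ 0 q1 q2 q3
    (fun k s => g k ((1 / 2 : ℚ) : ℝ) s)
    (![none, some 0, none, some 1, some 2] : Fin 5 → Option (Fin 3)) 1 (by decide)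
    (fun i s _ _ => by
      obtain ⟨-, -, -, ⟨e0, e1, e2, e3, e4⟩⟩ := edge_C1 f g hfg s
      simp only [hq]
      fin_cases i <;> simp [e0, e1, e2, e3, e4])
  exact ⟨cf, φ, f, g, hcf, hφ, hf, hg, hfg, IHlo, IHhi, IVlo, IVhi, hIHlo, hIHhi, hIVlo, hIVhi⟩

include CP hrel hmul hunit in
/-- **Chart C1** (vertex `(0,0)`, `(ξ,η) = (u,v)`): the corner principle instantiated —
letter densities (closed forms), the four side families, their end-regularised series, and the
corner identity at the residues `Z = (t0 1, t0 1 + t0 2 + t1 2, t1 2, t2 3, t1 3)`.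
[cite: Drinfeld1991, §2] -/
theorem chart_C1 (Z : Fin 5 → DrinfeldKohnoTrunc R (Fin 4) N)
    (hZ : Z = ![DrinfeldKohnoTrunc.t R N 0 1,
      DrinfeldKohnoTrunc.t R N 0 1 + DrinfeldKohnoTrunc.t R N 0 2 + DrinfeldKohnoTrunc.t R N 1 2,
      DrinfeldKohnoTrunc.t R N 1 2, DrinfeldKohnoTrunc.t R N 2 3, DrinfeldKohnoTrunc.t R N 1 3]) :
    ∃ f g : Fin 5 → ℝ → ℝ → ℝ,
      (∀ x y : ℝ, (f 0 x y = 1 / x ∧ f 1 x y = 0 ∧ f 2 x y = -1 / (1 - x) ∧ f 3 x y = 0 ∧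
        f 4 x y = -y / (1 - x * y)) ∧ (g 0 x y = 0 ∧ g 1 x y = 1 / y ∧ g 2 x y = 0 ∧
        g 3 x y = -1 / (1 - y) ∧ g 4 x y = -x / (1 - x * y))) ∧
      ∃ IHlo IHhi IVlo IVhi : (w : List (Fin 5)) → KZ.IntegralRep w.length,
        (∀ w : List (Fin 5), w.getLast? ≠ some 0 →
          (IHlo w).domain = {t | (∀ i, 0 < t i ∧ t i < ((1 / 2 : ℚ) : ℝ)) ∧ StrictAnti t} ∧
          Set.EqOn (IHlo w).integrand (fun t => ∏ i, f (w.get i) (t i) 0)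
            (IHlo w).domain) ∧
        (∀ w : List (Fin 5), w.getLast? ≠ some 0 →
          (IHhi w).domain = {t | (∀ i, 0 < t i ∧ t i < ((1 / 2 : ℚ) : ℝ)) ∧ StrictAnti t} ∧
          Set.EqOn (IHhi w).integrand (fun t => ∏ i, f (w.get i) (t i) ((1 / 2 : ℚ) : ℝ))
            (IHhi w).domain) ∧
        (∀ w : List (Fin 5), w.getLast? ≠ some 1 →
          (IVlo w).domain = {t | (∀ i, 0 < t i ∧ t i < ((1 / 2 : ℚ) : ℝ)) ∧ StrictAnti t} ∧
          Set.EqOn (IVlo w).integrand (fun t => ∏ i, g (w.get i) 0 (t i))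
            (IVlo w).domain) ∧
        (∀ w : List (Fin 5), w.getLast? ≠ some 1 →
          (IVhi w).domain = {t | (∀ i, 0 < t i ∧ t i < ((1 / 2 : ℚ) : ℝ)) ∧ StrictAnti t} ∧
          Set.EqOn (IVhi w).integrand (fun t => ∏ i, g (w.get i) ((1 / 2 : ℚ) : ℝ) (t i))
            (IVhi w).domain) ∧
        ∃ PHlo PHhi PVlo PVhi : NCSeries (Fin 5) R,
          (∀ W, PHlo W = if W = [] then 1 else
            Shuffle.pair (fun w => χ (KZ.of (IHlo w))) (Shuffle.regEnd 0 W)) ∧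
          (∀ W, PHhi W = if W = [] then 1 else
            Shuffle.pair (fun w => χ (KZ.of (IHhi w))) (Shuffle.regEnd 0 W)) ∧
          (∀ W, PVlo W = if W = [] then 1 else
            Shuffle.pair (fun w => χ (KZ.of (IVlo w))) (Shuffle.regEnd 1 W)) ∧
          (∀ W, PVhi W = if W = [] then 1 else
            Shuffle.pair (fun w => χ (KZ.of (IVhi w))) (Shuffle.regEnd 1 W)) ∧
          NCSeries.evalTrunc N Z PVhi * NCSeries.evalTrunc N Z PHlo =
            NCSeries.evalTrunc N Z PHhi * NCSeries.evalTrunc N Z PVlo := by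
  subst hZ
  obtain ⟨cf, φ, f, g, hcf, hφ, hf, hg, hfg, IHlo, IHhi, IVlo, IVhi, hIHlo, hIHhi, hIVlo, hIVhi⟩ :=
    families_C1
  refine ⟨f, g, hfg, IHlo, IHhi, IVlo, IVhi, hIHlo, hIHhi, hIVlo, hIVhi,
    fun W => if W = [] then 1 else Shuffle.pair (fun w => χ (KZ.of (IHlo w))) (Shuffle.regEnd 0 W),
    fun W => if W = [] then 1 else Shuffle.pair (fun w => χ (KZ.of (IHhi w))) (Shuffle.regEnd 0 W),
    fun W => if W = [] then 1 else Shuffle.pair (fun w => χ (KZ.of (IVlo w))) (Shuffle.regEnd 1 W),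
    fun W => if W = [] then 1 else Shuffle.pair (fun w => χ (KZ.of (IVhi w))) (Shuffle.regEnd 1 W),
    fun _ => rfl, fun _ => rfl, fun _ => rfl, fun _ => rfl, ?_⟩
  -- the corner principle
  refine CP R χ hrel hmul hunit 3 N (1 / 2) (1 / 2) (by norm_num) (by norm_num) cf
    (by subst hcf; rfl) (by subst hcf; rfl) φ f g hφ hf hg (hreg_C1 cf hcf φ hφ) _ _
    (fun k => (sum_nZ_C1 (S := ℝ) (N := N) _ rfl k).symm) (comm01_C1 _ rfl)
    (fun x y hx0 hx1 hy0 hy1 => ?_) (fun y hy0 hy1 => ?_) (fun x hx0 hx1 => ?_)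
    IHlo IHhi IVlo IVhi hIHlo hIHhi hIVlo hIVhi _ _ _ _ (fun _ => rfl) (fun _ => rfl)
    (fun _ => rfl) (fun _ => rfl) _ (fun k => (sum_nZ_C1 (S := R) (N := N) _ rfl k).symm)
  · -- flatness on the open chart
    obtain ⟨⟨a0, a1, a2, a3, a4⟩, b0, b1, b2, b3, b4⟩ := hfg x y
    have hx1' : x < 1 / 2 := by simpa using hx1
    have hy1' : y < 1 / 2 := by simpa using hy1
    have hx : x ≠ 0 := hx0.ne'
    have hy : y ≠ 0 := hy0.ne'
    have h1x : 1 - x ≠ 0 := by intro h; linarith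
    have h1y : 1 - y ≠ 0 := by intro h; linarith
    have hden : 1 - x * y ≠ 0 := by nlinarith [mul_pos hx0 hy0]
    refine flat_C1 _ rfl (fun k => f k x y) (fun l => g l x y) a1 a3 b0 b2 ?_ ?_
    · show f 0 x y * g 4 x y = f 4 x y * g 1 x y
      rw [a0, b4, a4, b1]
      field_simp
    · show f 2 x y * g 4 x y = f 4 x y * g 1 x y + f 2 x y * g 3 x y - f 4 x y * g 3 x y
      rw [a2, b4, a4, b1, b3]
      field_simp
      ring
  · -- centrality of `Z₀` on the edge `ξ = 0`
    obtain ⟨-, b0, b1, b2, b3, b4⟩ := hfg 0 y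
    exact central0_C1 _ rfl (fun l => g l 0 y) b0 b2 (by rw [b4]; simp)
  · -- centrality of `Z₁` on the edge `η = 0`
    obtain ⟨⟨a0, a1, a2, a3, a4⟩, -⟩ := hfg x 0
    exact central1_C1 _ rfl (fun k => f k x 0) a1 a3 (by rw [a4]; simp)

/-- **The side families of chart C2** (vertex `(1,0)`, `(ξ,η) = (1-u,v)`): the divisors `φ_k`, the
letter densities `f_k = ∂_ξ log φ_k`, `g_k = ∂_η log φ_k` (with their closed forms) and the four
families of KZ representations of the iterated integrals along the sides `η = 0`, `η = 1/2`,
`ξ = 0`, `ξ = 1/2` (words not ending in the side's regularised letter).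
[cite: KontsevichZagier2001, §1.1] -/
theorem families_C2 :
    ∃ (cf : Fin 5 → Fin 4 → ℚ) (φ f g : Fin 5 → ℝ → ℝ → ℝ),
      cf = ![![0, 1, 0, 0], ![0, 0, 1, 0], ![1, -1, 0, 0], ![1, 0, -1, 0], ![1, 0, -1, 1]] ∧
      (∀ k x y, φ k x y = cf k 0 + cf k 1 * x + cf k 2 * y + cf k 3 * x * y) ∧
      (∀ k x y, f k x y = (cf k 1 + cf k 3 * y) / φ k x y) ∧
      (∀ k x y, g k x y = (cf k 2 + cf k 3 * x) / φ k x y) ∧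
      (∀ x y : ℝ, (f 0 x y = 1 / x ∧ f 1 x y = 0 ∧ f 2 x y = -1 / (1 - x) ∧ f 3 x y = 0 ∧
        f 4 x y = y / (1 - y + x * y)) ∧ (g 0 x y = 0 ∧ g 1 x y = 1 / y ∧ g 2 x y = 0 ∧
        g 3 x y = -1 / (1 - y) ∧ g 4 x y = (-1 + x) / (1 - y + x * y))) ∧
      ∃ IHlo IHhi IVlo IVhi : (w : List (Fin 5)) → KZ.IntegralRep w.length,
        (∀ w : List (Fin 5), w.getLast? ≠ some 0 →
          (IHlo w).domain = {t | (∀ i, 0 < t i ∧ t i < ((1 / 2 : ℚ) : ℝ)) ∧ StrictAnti t} ∧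
          Set.EqOn (IHlo w).integrand (fun t => ∏ i, f (w.get i) (t i) 0)
            (IHlo w).domain) ∧
        (∀ w : List (Fin 5), w.getLast? ≠ some 0 →
          (IHhi w).domain = {t | (∀ i, 0 < t i ∧ t i < ((1 / 2 : ℚ) : ℝ)) ∧ StrictAnti t} ∧
          Set.EqOn (IHhi w).integrand (fun t => ∏ i, f (w.get i) (t i) ((1 / 2 : ℚ) : ℝ))
            (IHhi w).domain) ∧
        (∀ w : List (Fin 5), w.getLast? ≠ some 1 →
          (IVlo w).domain = {t | (∀ i, 0 < t i ∧ t i < ((1 / 2 : ℚ) : ℝ)) ∧ StrictAnti t} ∧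
          Set.EqOn (IVlo w).integrand (fun t => ∏ i, g (w.get i) 0 (t i))
            (IVlo w).domain) ∧
        (∀ w : List (Fin 5), w.getLast? ≠ some 1 →
          (IVhi w).domain = {t | (∀ i, 0 < t i ∧ t i < ((1 / 2 : ℚ) : ℝ)) ∧ StrictAnti t} ∧
          Set.EqOn (IVhi w).integrand (fun t => ∏ i, g (w.get i) ((1 / 2 : ℚ) : ℝ) (t i))
            (IVhi w).domain) := by
  -- the chart: divisors and letter densities
  obtain ⟨cf, hcf⟩ : ∃ cf : Fin 5 → Fin 4 → ℚ,
      cf = ![![0, 1, 0, 0], ![0, 0, 1, 0], ![1, -1, 0, 0], ![1, 0, -1, 0], ![1, 0, -1, 1]] :=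
    ⟨_, rfl⟩
  obtain ⟨φ, f, g, hφ, hf, hg⟩ : ∃ φ f g : Fin 5 → ℝ → ℝ → ℝ,
      (∀ k x y, φ k x y = cf k 0 + cf k 1 * x + cf k 2 * y + cf k 3 * x * y) ∧
      (∀ k x y, f k x y = (cf k 1 + cf k 3 * y) / φ k x y) ∧
      (∀ k x y, g k x y = (cf k 2 + cf k 3 * x) / φ k x y) :=
    ⟨_, _, _, fun _ _ _ => rfl, fun _ _ _ => rfl, fun _ _ _ => rfl⟩
  have hfg := fg_C2 cf hcf φ f g hφ hf hg
  have hβq : ∃ q : ℚ, ((1 / 2 : ℚ) : ℝ) = q := ⟨1 / 2, rfl⟩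
  have hβ1 : ((1 / 2 : ℚ) : ℝ) ≤ 1 := by norm_num
  have hq : ((1 / 2 : ℚ) : ℝ) = 2⁻¹ := by norm_num
  obtain ⟨q1, q2, q3⟩ := poles_012
  obtain ⟨r1, r2, r3⟩ := poles_01m
  -- the four side families
  obtain ⟨IHlo, hIHlo⟩ := exists_sideFamily ((1 / 2 : ℚ) : ℝ) hβq hβ1 _ 0 q1 q2 q3
    (fun k s => f k s 0)
    (![some 0, none, some 1, none, none] : Fin 5 → Option (Fin 3)) 0 (by decide)
    (fun i s _ _ => by
      obtain ⟨⟨e0, e1, e2, e3, e4⟩, -, -, -⟩ := edge_C2 f g hfg s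
      fin_cases i <;> simp [e0, e1, e2, e3, e4])
  obtain ⟨IHhi, hIHhi⟩ := exists_sideFamily ((1 / 2 : ℚ) : ℝ) hβq hβ1 _ 0 r1 r2 r3
    (fun k s => f k s ((1 / 2 : ℚ) : ℝ))
    (![some 0, none, some 1, none, some 2] : Fin 5 → Option (Fin 3)) 0 (by decide)
    (fun i s _ _ => by
      obtain ⟨-, ⟨e0, e1, e2, e3, e4⟩, -, -⟩ := edge_C2 f g hfg s
      simp only [hq]
      fin_cases i <;> simp [e0, e1, e2, e3, e4])
  obtain ⟨IVlo, hIVlo⟩ := exists_sideFamily ((1 / 2 : ℚ) : ℝ) hβq hβ1 _ 0 q1 q2 q3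
    (fun k s => g k 0 s)
    (![none, some 0, none, some 1, some 1] : Fin 5 → Option (Fin 3)) 1 (by decide)
    (fun i s _ _ => by
      obtain ⟨-, -, ⟨e0, e1, e2, e3, e4⟩, -⟩ := edge_C2 f g hfg s
      fin_cases i <;> simp [e0, e1, e2, e3, e4])
  obtain ⟨IVhi, hIVhi⟩ := exists_sideFamily ((1 / 2 : ℚ) : ℝ) hβq hβ1 _ 0 q1 q2 q3
    (fun k s => g k ((1 / 2 : ℚ) : ℝ) s)
    (![none, some 0, none, some 1, some 2] : Fin 5 → Option (Fin 3)) 1 (by decide)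
    (fun i s _ _ => by
      obtain ⟨-, -, -, ⟨e0, e1, e2, e3, e4⟩⟩ := edge_C2 f g hfg s
      simp only [hq]
      fin_cases i <;> simp [e0, e1, e2, e3, e4])
  exact ⟨cf, φ, f, g, hcf, hφ, hf, hg, hfg, IHlo, IHhi, IVlo, IVhi, hIHlo, hIHhi, hIVlo, hIVhi⟩

include CP hrel hmul hunit in
/-- **Chart C2** (vertex `(1,0)`, `(ξ,η) = (1-u,v)`): the corner principle instantiated —
letter densities (closed forms), the four side families, their end-regularised series, and the
corner identity at the residues `Z = (t1 2, t0 1 + t0 2 + t1 2, t0 1, t2 3, t1 3)`.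
[cite: Drinfeld1991, §2] -/
theorem chart_C2 (Z : Fin 5 → DrinfeldKohnoTrunc R (Fin 4) N)
    (hZ : Z = ![DrinfeldKohnoTrunc.t R N 1 2,
      DrinfeldKohnoTrunc.t R N 0 1 + DrinfeldKohnoTrunc.t R N 0 2 + DrinfeldKohnoTrunc.t R N 1 2,
      DrinfeldKohnoTrunc.t R N 0 1, DrinfeldKohnoTrunc.t R N 2 3, DrinfeldKohnoTrunc.t R N 1 3]) :
    ∃ f g : Fin 5 → ℝ → ℝ → ℝ,
      (∀ x y : ℝ, (f 0 x y = 1 / x ∧ f 1 x y = 0 ∧ f 2 x y = -1 / (1 - x) ∧ f 3 x y = 0 ∧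
        f 4 x y = y / (1 - y + x * y)) ∧ (g 0 x y = 0 ∧ g 1 x y = 1 / y ∧ g 2 x y = 0 ∧
        g 3 x y = -1 / (1 - y) ∧ g 4 x y = (-1 + x) / (1 - y + x * y))) ∧
      ∃ IHlo IHhi IVlo IVhi : (w : List (Fin 5)) → KZ.IntegralRep w.length,
        (∀ w : List (Fin 5), w.getLast? ≠ some 0 →
          (IHlo w).domain = {t | (∀ i, 0 < t i ∧ t i < ((1 / 2 : ℚ) : ℝ)) ∧ StrictAnti t} ∧
          Set.EqOn (IHlo w).integrand (fun t => ∏ i, f (w.get i) (t i) 0)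
            (IHlo w).domain) ∧
        (∀ w : List (Fin 5), w.getLast? ≠ some 0 →
          (IHhi w).domain = {t | (∀ i, 0 < t i ∧ t i < ((1 / 2 : ℚ) : ℝ)) ∧ StrictAnti t} ∧
          Set.EqOn (IHhi w).integrand (fun t => ∏ i, f (w.get i) (t i) ((1 / 2 : ℚ) : ℝ))
            (IHhi w).domain) ∧
        (∀ w : List (Fin 5), w.getLast? ≠ some 1 →
          (IVlo w).domain = {t | (∀ i, 0 < t i ∧ t i < ((1 / 2 : ℚ) : ℝ)) ∧ StrictAnti t} ∧
          Set.EqOn (IVlo w).integrand (fun t => ∏ i, g (w.get i) 0 (t i))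
            (IVlo w).domain) ∧
        (∀ w : List (Fin 5), w.getLast? ≠ some 1 →
          (IVhi w).domain = {t | (∀ i, 0 < t i ∧ t i < ((1 / 2 : ℚ) : ℝ)) ∧ StrictAnti t} ∧
          Set.EqOn (IVhi w).integrand (fun t => ∏ i, g (w.get i) ((1 / 2 : ℚ) : ℝ) (t i))
            (IVhi w).domain) ∧
        ∃ PHlo PHhi PVlo PVhi : NCSeries (Fin 5) R,
          (∀ W, PHlo W = if W = [] then 1 else
            Shuffle.pair (fun w => χ (KZ.of (IHlo w))) (Shuffle.regEnd 0 W)) ∧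
          (∀ W, PHhi W = if W = [] then 1 else
            Shuffle.pair (fun w => χ (KZ.of (IHhi w))) (Shuffle.regEnd 0 W)) ∧
          (∀ W, PVlo W = if W = [] then 1 else
            Shuffle.pair (fun w => χ (KZ.of (IVlo w))) (Shuffle.regEnd 1 W)) ∧
          (∀ W, PVhi W = if W = [] then 1 else
            Shuffle.pair (fun w => χ (KZ.of (IVhi w))) (Shuffle.regEnd 1 W)) ∧
          NCSeries.evalTrunc N Z PVhi * NCSeries.evalTrunc N Z PHlo =
            NCSeries.evalTrunc N Z PHhi * NCSeries.evalTrunc N Z PVlo := by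
  subst hZ
  obtain ⟨cf, φ, f, g, hcf, hφ, hf, hg, hfg, IHlo, IHhi, IVlo, IVhi, hIHlo, hIHhi, hIVlo, hIVhi⟩ :=
    families_C2
  refine ⟨f, g, hfg, IHlo, IHhi, IVlo, IVhi, hIHlo, hIHhi, hIVlo, hIVhi,
    fun W => if W = [] then 1 else Shuffle.pair (fun w => χ (KZ.of (IHlo w))) (Shuffle.regEnd 0 W),
    fun W => if W = [] then 1 else Shuffle.pair (fun w => χ (KZ.of (IHhi w))) (Shuffle.regEnd 0 W),
    fun W => if W = [] then 1 else Shuffle.pair (fun w => χ (KZ.of (IVlo w))) (Shuffle.regEnd 1 W),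
    fun W => if W = [] then 1 else Shuffle.pair (fun w => χ (KZ.of (IVhi w))) (Shuffle.regEnd 1 W),
    fun _ => rfl, fun _ => rfl, fun _ => rfl, fun _ => rfl, ?_⟩
  -- the corner principle
  refine CP R χ hrel hmul hunit 3 N (1 / 2) (1 / 2) (by norm_num) (by norm_num) cf
    (by subst hcf; rfl) (by subst hcf; rfl) φ f g hφ hf hg (hreg_C2 cf hcf φ hφ) _ _
    (fun k => (sum_nZ_C2 (S := ℝ) (N := N) _ rfl k).symm) (comm01_C2 _ rfl)
    (fun x y hx0 hx1 hy0 hy1 => ?_) (fun y hy0 hy1 => ?_) (fun x hx0 hx1 => ?_)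
    IHlo IHhi IVlo IVhi hIHlo hIHhi hIVlo hIVhi _ _ _ _ (fun _ => rfl) (fun _ => rfl)
    (fun _ => rfl) (fun _ => rfl) _ (fun k => (sum_nZ_C2 (S := R) (N := N) _ rfl k).symm)
  · -- flatness on the open chart
    obtain ⟨⟨a0, a1, a2, a3, a4⟩, b0, b1, b2, b3, b4⟩ := hfg x y
    have hx1' : x < 1 / 2 := by simpa using hx1
    have hy1' : y < 1 / 2 := by simpa using hy1
    have hx : x ≠ 0 := hx0.ne'
    have hy : y ≠ 0 := hy0.ne'
    have h1x : 1 - x ≠ 0 := by intro h; linarith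
    have h1y : 1 - y ≠ 0 := by intro h; linarith
    have hden : 1 - y + x * y ≠ 0 := by nlinarith [mul_pos hx0 hy0]
    refine flat_C2 _ rfl (fun k => f k x y) (fun l => g l x y) a1 a3 b0 b2 ?_ ?_
    · show f 2 x y * g 4 x y = f 4 x y * g 1 x y
      rw [a2, b4, a4, b1]
      field_simp
      ring
    · show f 0 x y * g 4 x y = f 0 x y * g 3 x y + f 4 x y * g 1 x y - f 4 x y * g 3 x y
      rw [a0, b4, b3, a4, b1]
      field_simp
      ring
  · -- centrality of `Z₀` on the edge `ξ = 0`
    obtain ⟨-, b0, b1, b2, b3, b4⟩ := hfg 0 y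
    exact central0_C2 _ rfl (fun l => g l 0 y) b0 b2 (by rw [b4, b3]; ring)
  · -- centrality of `Z₁` on the edge `η = 0`
    obtain ⟨⟨a0, a1, a2, a3, a4⟩, -⟩ := hfg x 0
    exact central1_C2 _ rfl (fun k => f k x 0) a1 a3 (by rw [a4]; simp)

end Charts

end CornersCubical

/-- **Sub-stub `cornersCubical_familiesC1` of `stub_cornersCubical`**: the divisors, letter
densities (with closed forms) and the four side families of KZ representations of the corner
chart C1 (vertex `(0,0)` of the pentagon cell, chart `[0, 1/2]²`).
[cite: KontsevichZagier2001, §1.1] -/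
theorem cornersCubical_familiesC1 :
    ∃ (cf : Fin 5 → Fin 4 → ℚ) (φ f g : Fin 5 → ℝ → ℝ → ℝ), cf = ![![0, 1, 0, 0], ![0, 0, 1, 0], ![1, -1, 0, 0], ![1, 0, -1, 0], ![1, 0, 0, -1]] ∧ (∀ k x y, φ k x y = cf k 0 + cf k 1 * x + cf k 2 * y + cf k 3 * x * y) ∧ (∀ k x y, f k x y = (cf k 1 + cf k 3 * y) / φ k x y) ∧ (∀ k x y, g k x y = (cf k 2 + cf k 3 * x) / φ k x y) ∧ (∀ x y : ℝ, (f 0 x y = 1 / x ∧ f 1 x y = 0 ∧ f 2 x y = -1 / (1 - x) ∧ f 3 x y = 0 ∧ f 4 x y = -y / (1 - x * y)) ∧ (g 0 x y = 0 ∧ g 1 x y = 1 / y ∧ g 2 x y = 0 ∧ g 3 x y = -1 / (1 - y) ∧ g 4 x y = -x / (1 - x * y))) ∧ ∃ IHlo IHhi IVlo IVhi : (w : List (Fin 5)) → KZ.IntegralRep w.length, (∀ w : List (Fin 5), w.getLast? ≠ some 0 → (IHlo w).domain = {t | (∀ i, 0 < t i ∧ t i < ((1 / 2 : ℚ) : ℝ))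 ∧ StrictAnti t} ∧ Set.EqOn (IHlo w).integrand (fun t => ∏ i, f (w.get i) (t i) 0) (IHlo w).domain) ∧ (∀ w : List (Fin 5), w.getLast? ≠ some 0 → (IHhi w).domain = {t | (∀ i, 0 < t i ∧ t i < ((1 / 2 : ℚ) : ℝ)) ∧ StrictAnti t} ∧ Set.EqOn (IHhi w).integrand (fun t => ∏ i, f (w.get i) (t i) ((1 / 2 : ℚ) : ℝ)) (IHhi w).domain) ∧ (∀ w : List (Fin 5), w.getLast? ≠ some 1 → (IVlo w).domain = {t | (∀ i, 0 < t i ∧ t i < ((1 / 2 : ℚ) : ℝ)) ∧ StrictAnti t} ∧ Set.EqOn (IVlo w).integrand (fun t => ∏ i, g (w.get i) 0 (t i)) (IVlo w).domain) ∧ (∀ w : List (Fin 5), w.getLast? ≠ some 1 → (IVhi w).domain = {t | (∀ i, 0 < t i ∧ t i < ((1 / 2 : ℚ) : ℝ)) ∧ StrictAnti t} ∧ Set.EqOn (IVhi w).integrand (fun t => ∏ i, g (w.get i) ((1 / 2 : ℚ) : ℝ) (t i)) (IVhi w).domain) :=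
  CornersCubical.families_C1

end Summit.KontsevichZagierPeriods.FurushoPentagon.PentagonInKZ
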